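import Literature.NumberTheory.GaloisRepresentations.RayClassGroupModulusChangeUnits
import Literature.NumberTheory.NumberFields.RayClassFieldSplitPrimePowerDegreeQuadratic
import HarnessLib

/-!
# `[K(𝔭^{n+1}) : K(𝔭)] = 2^{n-1}` for `K = ℚ(√-7)` and `𝔭 ∣ 2` split — the `𝔣 = 1` division tower
# (de Shalit 1987, II.1.9 with the unit correction: `w_𝔣 = 1` fails for `𝔣 = 1`)

For an imaginary quadratic field `K` with `𝓞_K^× = {±1}` and a split prime `𝔭 = v` above `2`
(`2 = v v̄`, so `𝓞/v ≅ 𝔽₂`, `𝓞/v^{n+1} ≅ ℤ/2^{n+1}`), the ray class fields `K(v^{n+1})` satisfy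
`[K(v^{n+1}) : K(v)] = #((𝓞/v^{n+1})ˣ → (𝓞/v)ˣ kernel) / [U_v¹ : U_{v^{n+1}}¹] = 2^n / 2 = 2^{n-1}`
(`n ≥ 1`): both units `±1` are `≡ 1 mod v` (`2 ∈ v`) but only `1` is `≡ 1 mod v^{n+1}` (`2 ∉ v²`). This is
the modulus-change exact sequence `RayClassGroupModulusChangeUnits.natCard_rayClassGroup_mul_relIndex_units_eq`
made explicit — the instance of de Shalit II.1.9 at `𝔣 = 1`, where the hypothesis `w_𝔣 = 1` of
`RayClassFieldSplitPrimePowerDegree*.lean` FAILS and the degree `2^n` there is halved: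

* §0 `natCard_ker_unitsMap_factor_congr` — the kernel count only depends on the target ideal (transport
  along `v^1 = v`);
* §1 `ker_unitsMap_mk_eq_top_of_two_mem` / `ker_unitsMap_mk_eq_bot_of_two_not_mem` — for `𝓞^× = {±1}`:
  `U_𝔫¹ = 𝓞^×` if `2 ∈ 𝔫`, `U_𝔫¹ = 1` if `2 ∉ 𝔫`; `relIndex_ker_unitsMap_pow_succ_eq_two`:
  `[U_v¹ : U_{v^{n+1}}¹] = 2` (`n ≥ 1`, `2 ∈ v`, `2 ∉ v²`);
* §2 ★ `natCard_rayClassGroup_pow_succ_mul_two` — `#Cl^{v^{n+1}} · 2 = #Cl^{v} · 2^n` and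
  `natCard_rayClassGroup_pow_succ_eq` — `#Cl^{v^{n+1}} = #Cl^{v} · 2^{n-1}` (`[K:ℚ] = 2` totally complex,
  `#𝓞^× = 2`, `2 ∈ v, v̄`, `v̄ ≠ v`, `n ≥ 1`);
* §3 ★★ degrees: `finrank_rayClassField_pow_succ_eq` (`[K(v^{n+1}):K] = [K(v):K]·2^{n-1}`),
  `relfinrank_rayClassField_pow_succ` (`[K(v^{n+1}) : K(v)] = 2^{n-1}`, all `n`, reading `2^{0-1} = 1`),
  `relIndex_fixingSubgroup_rayClassField_pow_succ` (Galois form: `[Gal(K̄/K(v)) : Gal(K̄/K(v^{n+1}))] =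
  2^{n-1}`), and the `IsImaginaryQuadratic K`, `d_K < -4` wrapper
  `relIndex_fixingSubgroup_rayClassField_pow_succ_of_isImaginaryQuadratic`.

Not here: `#Cl^{v} = h_K` (`(𝓞/v)ˣ = 1`), hence `[K(v^{n+1}) : K] = h_K · 2^{n-1}`.

Everything is a theorem; no definitions, no named facts, no instances, no `sorry`.
-/

noncomputable section

open NumberField IsDedekindDomain IsDedekindDomain.HeightOneSpectrum IntermediateField Module

namespace Literature.NumberTheory.NumberFields

open Literature.NumberTheory.GaloisRepresentations

/-! ### §0. Transport of the kernel count along an equality of ideals -/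

/-- The kernel count `#ker((R/𝔞')ˣ → (R/𝔞)ˣ)` only depends on the ideal `𝔞` (transport along `𝔞₁ = 𝔞₂`,
e.g. `v^1 = v`); private plumbing. [folklore] -/
private theorem natCard_ker_unitsMap_factor_congr {R : Type*} [CommRing R] {𝔞' 𝔞₁ 𝔞₂ : Ideal R} (h : 𝔞₁ = 𝔞₂)
    (h₁ : 𝔞' ≤ 𝔞₁) (h₂ : 𝔞' ≤ 𝔞₂) :
    Nat.card (Units.map (Ideal.Quotient.factor h₁).toMonoidHom : (R ⧸ 𝔞')ˣ →* (R ⧸ 𝔞₁)ˣ).ker =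
      Nat.card (Units.map (Ideal.Quotient.factor h₂).toMonoidHom : (R ⧸ 𝔞')ˣ →* (R ⧸ 𝔞₂)ˣ).ker := by
  subst h
  rfl

/-! ### §1. The unit groups `U_𝔫¹` when `𝓞^× = {±1}` -/

section Units

variable {K : Type*} [Field K] [NumberField K]

/-- If `𝓞_K^× = {±1}` and `2 ∈ 𝔫` then every unit is `≡ 1 mod 𝔫`: `U_𝔫¹ = 𝓞^×`.
[cite: deShalit1987, II.1.9 (p. 43)] [cite: Cox2013, §7.D Thm. 7.24 (units)] -/
theorem ker_unitsMap_mk_eq_top_of_two_mem (hunits : Nat.card (𝓞 K)ˣ = 2) {𝔫 : Ideal (𝓞 K)}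
    (h2 : (2 : 𝓞 K) ∈ 𝔫) :
    (Units.map (Ideal.Quotient.mk 𝔫).toMonoidHom : (𝓞 K)ˣ →* (𝓞 K ⧸ 𝔫)ˣ).ker = ⊤ := by
  rw [eq_top_iff]
  intro u _
  rw [MonoidHom.mem_ker]
  apply Units.ext
  change Ideal.Quotient.mk 𝔫 (u : 𝓞 K) = ((1 : (𝓞 K ⧸ 𝔫)ˣ) : 𝓞 K ⧸ 𝔫)
  rw [Units.val_one, ← map_one (Ideal.Quotient.mk 𝔫), Ideal.Quotient.eq]
  rcases units_eq_one_or_eq_neg_one_of_natCard_eq_two hunits u with rfl | rfl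
  · simp
  · have : ((-1 : (𝓞 K)ˣ) : 𝓞 K) - 1 = -2 := by rw [Units.val_neg, Units.val_one]; norm_num
    rw [this]
    exact 𝔫.neg_mem h2

/-- If `𝓞_K^× = {±1}` and `2 ∉ 𝔫` then `U_𝔫¹ = 1`. [cite: deShalit1987, II.1.9 (p. 43)]
[cite: Cox2013, §7.D Thm. 7.24 (units)] -/
theorem ker_unitsMap_mk_eq_bot_of_two_not_mem (hunits : Nat.card (𝓞 K)ˣ = 2) {𝔫 : Ideal (𝓞 K)}
    (h2 : (2 : 𝓞 K) ∉ 𝔫) :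
    (Units.map (Ideal.Quotient.mk 𝔫).toMonoidHom : (𝓞 K)ˣ →* (𝓞 K ⧸ 𝔫)ˣ).ker = ⊥ := by
  rw [eq_bot_iff]
  intro u hu
  rw [MonoidHom.mem_ker] at hu
  rw [Subgroup.mem_bot]
  refine units_eq_one_of_sub_one_mem_of_natCard_eq_two hunits h2 u ?_
  have h1 : ((Units.map (Ideal.Quotient.mk 𝔫).toMonoidHom u : (𝓞 K ⧸ 𝔫)ˣ) : 𝓞 K ⧸ 𝔫) = 1 := by
    rw [hu, Units.val_one]
  change Ideal.Quotient.mk 𝔫 (u : 𝓞 K) = 1 at h1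
  rw [← Ideal.Quotient.eq, map_one]
  exact h1

/-- **`[U_v¹ : U_{v^{n+1}}¹] = 2`** for `𝓞_K^× = {±1}`, `2 ∈ v`, `2 ∉ v²`, `n ≥ 1`.
[cite: deShalit1987, II.1.9 (p. 43)] -/
theorem relIndex_ker_unitsMap_pow_succ_eq_two (hunits : Nat.card (𝓞 K)ˣ = 2)
    (v : HeightOneSpectrum (𝓞 K)) (hv : (2 : 𝓞 K) ∈ v.asIdeal) (hv2 : (2 : 𝓞 K) ∉ v.asIdeal ^ 2)
    {n : ℕ} (hn : 1 ≤ n) :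
    (Units.map (Ideal.Quotient.mk (v.asIdeal ^ (n + 1))).toMonoidHom :
        (𝓞 K)ˣ →* (𝓞 K ⧸ v.asIdeal ^ (n + 1))ˣ).ker.relIndex
      (Units.map (Ideal.Quotient.mk v.asIdeal).toMonoidHom : (𝓞 K)ˣ →* (𝓞 K ⧸ v.asIdeal)ˣ).ker = 2 := by
  have h2' : (2 : 𝓞 K) ∉ v.asIdeal ^ (n + 1) := fun h ↦
    hv2 (Ideal.pow_le_pow_right (by omega : 2 ≤ n + 1) h)
  rw [ker_unitsMap_mk_eq_top_of_two_mem hunits hv, ker_unitsMap_mk_eq_bot_of_two_not_mem hunits h2',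
    Subgroup.relIndex_top_right, Subgroup.index_bot, hunits]

end Units

/-! ### §2. `#Cl^{v^{n+1}} · 2 = #Cl^{v} · 2^n` at a split prime above `2` -/

section Split

variable {K : Type*} [Field K] [NumberField K] [IsTotallyComplex K] (hK2 : finrank ℚ K = 2)
  (hunits : Nat.card (𝓞 K)ˣ = 2) {v vbar : HeightOneSpectrum (𝓞 K)}
  (hv : ((2 : ℕ) : 𝓞 K) ∈ v.asIdeal) (hvbar : ((2 : ℕ) : 𝓞 K) ∈ vbar.asIdeal) (hne : vbar ≠ v)
include hK2 hunits hv hvbar hne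

/-- ★ **`#Cl_K^{v^{n+1}} · 2 = #Cl_K^{v} · 2^n`** (`n ≥ 1`) for `[K:ℚ] = 2` totally complex with
`𝓞_K^× = {±1}` and `2 = v v̄` split: the modulus-change sequence with unit index `[U_v¹ : U_{v^{n+1}}¹] = 2`
and kernel `#ker((𝓞/v^{n+1})ˣ → (𝓞/v)ˣ) = #ker((ℤ/2^{n+1})ˣ → (ℤ/2)ˣ) = 2^n`.
[cite: deShalit1987, II.1.9 (p. 43)] [cite: NeukirchANT1999, Ch. VI §1 Prop. (1.11)] -/
theorem natCard_rayClassGroup_pow_succ_mul_two {n : ℕ} (hn : 1 ≤ n) :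
    Nat.card (RayClassGroup (v.asIdeal ^ (n + 1))) * 2 = Nat.card (RayClassGroup v.asIdeal) * 2 ^ n := by
  haveI : Fact (Nat.Prime 2) := ⟨Nat.prime_two⟩
  have hv0 : v.asIdeal ≠ ⊥ := v.ne_bot
  have hle : v.asIdeal ^ (n + 1) ≤ v.asIdeal := Ideal.pow_le_self (Nat.succ_ne_zero n)
  have h𝔪' : v.asIdeal ^ (n + 1) ≠ ⊥ := pow_ne_zero _ hv0
  have h𝔪1 : v.asIdeal ^ (n + 1) ≠ ⊤ := fun h ↦ v.isPrime.ne_top (top_le_iff.mp (h ▸ hle))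
  have hsupp : ∀ w : HeightOneSpectrum (𝓞 K), v.asIdeal ≤ w.asIdeal ↔ v.asIdeal ^ (n + 1) ≤ w.asIdeal :=
    fun w ↦ by rw [Ideal.IsPrime.pow_le_iff (Nat.succ_ne_zero n)]
  have hv' : (2 : 𝓞 K) ∈ v.asIdeal := by exact_mod_cast hv
  have hv2 : (2 : 𝓞 K) ∉ v.asIdeal ^ 2 := by
    exact_mod_cast natCast_not_mem_sq_of_mem_of_mem_of_ne hK2 Nat.prime_two hv hvbar hne
  have h := natCard_rayClassGroup_mul_relIndex_units_eq hv0 h𝔪' h𝔪1 hle hsupp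
  rw [relIndex_ker_unitsMap_pow_succ_eq_two hunits v hv' hv2 hn,
    natCard_ker_unitsMap_factor_congr (pow_one v.asIdeal).symm hle
      (Ideal.pow_le_pow_right (Nat.le_add_left 1 n)),
    natCard_ker_unitsMap_factor_pow v (natCard_quotient_eq_of_mem_of_mem_of_ne hK2 Nat.prime_two hv hvbar hne)
      (intValuation_natCast_eq_of_mem_of_mem_of_ne hK2 Nat.prime_two hv hvbar hne) n] at h
  exact h

/-- `#Cl_K^{v^{n+1}} = #Cl_K^{v} · 2^{n-1}` (`n ≥ 1`; same hypotheses). [cite: deShalit1987, II.1.9 (p. 43)] -/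
theorem natCard_rayClassGroup_pow_succ_eq {n : ℕ} (hn : 1 ≤ n) :
    Nat.card (RayClassGroup (v.asIdeal ^ (n + 1))) = Nat.card (RayClassGroup v.asIdeal) * 2 ^ (n - 1) := by
  have h := natCard_rayClassGroup_pow_succ_mul_two hK2 hunits hv hvbar hne hn
  obtain ⟨m, rfl⟩ := Nat.exists_eq_add_of_le' hn
  rw [pow_succ 2 m, ← mul_assoc] at h
  rw [Nat.add_sub_cancel]
  exact Nat.eq_of_mul_eq_mul_right two_pos h

end Split

/-! ### §3. The degrees `[K(v^{n+1}) : K(v)] = 2^{n-1}` -/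

section Degrees

variable {K : Type} [Field K] [NumberField K] [IsTotallyComplex K] (hK2 : finrank ℚ K = 2)
  (hunits : Nat.card (𝓞 K)ˣ = 2) {v vbar : HeightOneSpectrum (𝓞 K)}
  (hv : ((2 : ℕ) : 𝓞 K) ∈ v.asIdeal) (hvbar : ((2 : ℕ) : 𝓞 K) ∈ vbar.asIdeal) (hne : vbar ≠ v)

omit [IsTotallyComplex K] in
/-- `K(v) ≤ K(v^{n+1})`. [cite: deShalit1987, II.1.9 (p. 43)] -/
theorem rayClassField_le_pow_succ (v : HeightOneSpectrum (𝓞 K)) (n : ℕ) :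
    rayClassField K v.asIdeal ≤ rayClassField K (v.asIdeal ^ (n + 1)) :=
  rayClassField_le_of_le (pow_ne_zero _ v.ne_bot) (Ideal.pow_le_self (Nat.succ_ne_zero n))

include hK2 hunits hv hvbar hne

/-- `[K(v^{n+1}) : K] = [K(v) : K] · 2^{n-1}` (`n ≥ 1`) for `[K:ℚ] = 2` totally complex, `𝓞^× = {±1}`,
`2 = v v̄` split. [cite: deShalit1987, II.1.9 (p. 43)] -/
theorem finrank_rayClassField_pow_succ_eq {n : ℕ} (hn : 1 ≤ n) :
    finrank K (rayClassField K (v.asIdeal ^ (n + 1))) = finrank K (rayClassField K v.asIdeal) * 2 ^ (n - 1) := by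
  rw [finrank_rayClassField (pow_ne_zero _ v.ne_bot), finrank_rayClassField v.ne_bot,
    natCard_rayClassGroup_pow_succ_eq hK2 hunits hv hvbar hne hn]

/-- ★★ **`[K(v^{n+1}) : K(v)] = 2^{n-1}`** for `[K:ℚ] = 2` totally complex, `𝓞^× = {±1}`, `2 = v v̄` split
(all `n`; for `n = 0` both sides are `1`). De Shalit II.1.9 at `𝔣 = 1`: the unit `-1 ≡ 1 mod v` halves the
degree `#((1+2ℤ₂)/(1+2^{n+1}ℤ₂)) = 2^n`. [cite: deShalit1987, II.1.9 (p. 43)] -/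
theorem relfinrank_rayClassField_pow_succ (n : ℕ) :
    relfinrank (rayClassField K v.asIdeal) (rayClassField K (v.asIdeal ^ (n + 1))) = 2 ^ (n - 1) := by
  rcases Nat.eq_zero_or_pos n with rfl | hn
  · rw [zero_add, pow_one, Nat.zero_sub, pow_zero, IntermediateField.relfinrank_self]
  · have h := IntermediateField.finrank_bot_mul_relfinrank (rayClassField_le_pow_succ v n)
    rw [finrank_rayClassField_pow_succ_eq hK2 hunits hv hvbar hne hn] at h
    exact Nat.eq_of_mul_eq_mul_left Module.finrank_pos h

/-- ★★ **Galois form: `[Gal(K̄/K(v)) : Gal(K̄/K(v^{n+1}))] = 2^{n-1}`** inside `Gal(K̄/K)` (all `n`): the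
relative index of the fixing subgroups of the `𝔣 = 1` division tower `U n = Gal(K̄/K(v^{n+1}))` over
`U 0 = Gal(K̄/K(v))`. [cite: deShalit1987, II.1.9 (p. 43), II.4.6 (p. 59)] -/
theorem relIndex_fixingSubgroup_rayClassField_pow_succ (n : ℕ) :
    (rayClassField K (v.asIdeal ^ (n + 1))).fixingSubgroup.relIndex
      (rayClassField K v.asIdeal).fixingSubgroup = 2 ^ (n - 1) := by
  haveI : IsGalois K (AlgebraicClosure K) := {}
  rw [Literature.AnabelianGeometry.EtaleTheta.SettingGalois.relIndex_fixingSubgroup_eq_finrank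
    (rayClassField_le_pow_succ v n), ← IntermediateField.relfinrank_eq_finrank_of_le]
  exact relfinrank_rayClassField_pow_succ hK2 hunits hv hvbar hne n

end Degrees

section ImaginaryQuadratic

open Literature.NumberTheory.EllipticCurves

/-- ★★ **The cell's `𝔣 = 1` instance (`K = ℚ(√-7)`, `2 = v v̄`): `[Gal(K̄/K(v)) : Gal(K̄/K(v^{n+1}))] =
2^{n-1}`** for `K` imaginary quadratic with `d_K < -4`, `2 ∈ v`, `2 ∈ v̄`, `v̄ ≠ v`.
[cite: deShalit1987, II.1.9 (p. 43), II.4.6 (p. 59)] -/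
theorem relIndex_fixingSubgroup_rayClassField_pow_succ_of_isImaginaryQuadratic {K : Type} [Field K]
    [NumberField K] (hK : IsImaginaryQuadratic K) (hd : NumberField.discr K < -4)
    {v vbar : HeightOneSpectrum (𝓞 K)} (hv : ((2 : ℕ) : 𝓞 K) ∈ v.asIdeal)
    (hvbar : ((2 : ℕ) : 𝓞 K) ∈ vbar.asIdeal) (hne : vbar ≠ v) (n : ℕ) :
    (rayClassField K (v.asIdeal ^ (n + 1))).fixingSubgroup.relIndex
      (rayClassField K v.asIdeal).fixingSubgroup = 2 ^ (n - 1) := by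
  haveI := hK.isTotallyComplex
  exact relIndex_fixingSubgroup_rayClassField_pow_succ hK.1 (card_units_eq_two_of_discr_lt hK hd) hv hvbar
    hne n

/-- `[K(v^{n+1}) : K(v)] = 2^{n-1}` (`relfinrank` form) for `K` imaginary quadratic with `d_K < -4`,
`2 = v v̄` split. [cite: deShalit1987, II.1.9 (p. 43)] -/
theorem relfinrank_rayClassField_pow_succ_of_isImaginaryQuadratic {K : Type} [Field K]
    [NumberField K] (hK : IsImaginaryQuadratic K) (hd : NumberField.discr K < -4)
    {v vbar : HeightOneSpectrum (𝓞 K)} (hv : ((2 : ℕ) : 𝓞 K) ∈ v.asIdeal)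
    (hvbar : ((2 : ℕ) : 𝓞 K) ∈ vbar.asIdeal) (hne : vbar ≠ v) (n : ℕ) :
    relfinrank (rayClassField K v.asIdeal) (rayClassField K (v.asIdeal ^ (n + 1))) = 2 ^ (n - 1) := by
  haveI := hK.isTotallyComplex
  exact relfinrank_rayClassField_pow_succ hK.1 (card_units_eq_two_of_discr_lt hK hd) hv hvbar hne n

/-- `#Cl_K^{v^{n+1}} = #Cl_K^{v} · 2^{n-1}` (`n ≥ 1`) for `K` imaginary quadratic with `d_K < -4`,
`2 = v v̄` split. [cite: deShalit1987, II.1.9 (p. 43)] -/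
theorem natCard_rayClassGroup_pow_succ_eq_of_isImaginaryQuadratic {K : Type} [Field K]
    [NumberField K] (hK : IsImaginaryQuadratic K) (hd : NumberField.discr K < -4)
    {v vbar : HeightOneSpectrum (𝓞 K)} (hv : ((2 : ℕ) : 𝓞 K) ∈ v.asIdeal)
    (hvbar : ((2 : ℕ) : 𝓞 K) ∈ vbar.asIdeal) (hne : vbar ≠ v) {n : ℕ} (hn : 1 ≤ n) :
    Nat.card (RayClassGroup (v.asIdeal ^ (n + 1))) = Nat.card (RayClassGroup v.asIdeal) * 2 ^ (n - 1) := by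
  haveI := hK.isTotallyComplex
  exact natCard_rayClassGroup_pow_succ_eq hK.1 (card_units_eq_two_of_discr_lt hK hd) hv hvbar hne hn

end ImaginaryQuadratic

end Literature.NumberTheory.NumberFields

end
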